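import Literature.MathematicalPhysics.QuantumManyBody.PeriodicBoseGas
import Mathlib.Analysis.SpecialFunctions.Trigonometric.Bounds
import Mathlib.MeasureTheory.Measure.Haar.InnerProductSpace
import HarnessLib

/-!
# `|ĝ(p) - ĝ(0)| ≤ ½R²|p|² ĝ(0)` for a non-negative even function supported in `B(0, R)`

Topic `Literature/MathematicalPhysics/QuantumManyBody`, namespace `BoseGas` (provefact
`Literature.MathematicalPhysics.QuantumManyBody.BoseGas.Junge2026_neumannBox_pinnedLowerBound`; brick:
the elementary Fourier bound quoted in [FournaisEtAl2024] after (2.38) ("One easily checks that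
the argument of the square root is non-negative using that `|ĝ(p) - ĝ(0)| ≤ R²ĝ(0)|p|²`"), in
the proof of Lemma 8.1 ("we used ... that `|ĝ(p) - ĝ(0)| ≤ R²ĝ(0)|p|²`") and, for `gω`, in the
proof of Lemma 7.2 (`ĝω'(0) = 0` by radiality, `|ĝω''| ≤ ĝ(0)R²`), for `g = vφ_v ≥ 0` radial
with `supp g ⊆ B(0,R)`, `ĝ(p) = ∫ g(x)e^{-ip·x}dx`, `ĝ(0) = ∫ g = 8πa`).

For `g : ℝ³ → ℝ` with `g ≥ 0`, `g = 0` outside the closed ball of radius `R`, `g` integrable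
and even (`g(-x) = g(x)`), and every `p ∈ ℝ³`:
* `integral_mul_sin_inner_eq_zero` — `∫ g(x) sin(p·x) dx = 0` (oddness);
* `integral_mul_one_sub_cos_inner_le` — `0 ≤ ∫ g(x)(1 - cos(p·x)) dx ≤ ½|p|²R² ∫ g`
  (`1 - cos t ≤ t²/2`, `|p·x| ≤ |p|R` on the support);
* `norm_fourier_sub_fourier_zero_le_sq` — **`|ĝ(p) - ĝ(0)| ≤ ½R²|p|² ĝ(0)`** for
  `ĝ(p) = ∫ g(x)e^{-ip·x}dx` (written out; the paper's constant is `1`), and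
  `fourier_zero_sub_re_fourier` — `ĝ(0) - Re ĝ(p) = ∫ g(1 - cos(p·x)) ∈ [0, ½R²|p|²ĝ(0)]`,
  `im_fourier_eq_zero` — `ĝ(p)` is real;
* `norm_fourier_le` — `|ĝ(p)| ≤ ĝ(0)`.

No definitions.

## References

* [FournaisEtAl2024] S. Fournais, L. Junge, T. Girardot, L. Morin, M. Olivieri, A. Triay, *The free
  energy of dilute Bose gases at low temperatures interacting via strong potentials*,
  arXiv:2408.14222, Ann. Henri Poincaré (2026): remark after (2.38); proof of Lemma 8.1; proof of
  Lemma 7.2 (1).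
-/

noncomputable section

open MeasureTheory Set Filter Topology Metric Complex
open scoped RealInnerProductSpace

namespace Literature.MathematicalPhysics.QuantumManyBody.BoseGas

variable {g : Space → ℝ} {R : ℝ} {p : Space}

/-- Integration over `ℝ³` is invariant under `x ↦ -x`. [folklore] -/
theorem integral_comp_neg_space {E : Type*} [NormedAddCommGroup E] [NormedSpace ℝ E]
    (F : Space → E) : ∫ x : Space, F (-x) = ∫ x : Space, F x := by
  have h := (LinearIsometryEquiv.neg ℝ (E := Space)).measurePreserving.integral_comp
    (LinearIsometryEquiv.neg ℝ (E := Space)).toHomeomorph.measurableEmbedding F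
  simpa using h

/-- **`∫ g(x) sin(p·x) dx = 0` for even `g`.** [cite: FournaisEtAl2024, proof of Lemma 7.2 ("by radiality")] -/
theorem integral_mul_sin_inner_eq_zero (heven : ∀ x, g (-x) = g x) (p : Space) :
    ∫ x : Space, g x * Real.sin ⟪p, x⟫ = 0 := by
  have h := integral_comp_neg_space fun x : Space => g x * Real.sin ⟪p, x⟫
  simp only [heven, inner_neg_right, Real.sin_neg, mul_neg, integral_neg] at h
  linarith

/-- On the support, `|p·x| ≤ |p|R`, so `0 ≤ 1 - cos(p·x) ≤ ½|p|²R²` there. [folklore] -/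
theorem one_sub_cos_inner_le {x : Space} (hx : ‖x‖ ≤ R) (p : Space) :
    1 - Real.cos ⟪p, x⟫ ≤ ‖p‖ ^ 2 * R ^ 2 / 2 := by
  have h1 : 1 - Real.cos ⟪p, x⟫ ≤ ⟪p, x⟫ ^ 2 / 2 := by
    linarith [Real.one_sub_sq_div_two_le_cos (x := ⟪p, x⟫)]
  have h2 : |⟪p, x⟫| ≤ ‖p‖ * R := (abs_real_inner_le_norm p x).trans (by gcongr)
  have h3 : ⟪p, x⟫ ^ 2 ≤ (‖p‖ * R) ^ 2 := by
    rw [← sq_abs]; exact pow_le_pow_left₀ (abs_nonneg _) h2 2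
  calc 1 - Real.cos ⟪p, x⟫ ≤ ⟪p, x⟫ ^ 2 / 2 := h1
    _ ≤ (‖p‖ * R) ^ 2 / 2 := by linarith
    _ = ‖p‖ ^ 2 * R ^ 2 / 2 := by ring

/-- The integrand `g(x)(1 - cos(p·x))` is integrable. [folklore] -/
theorem integrable_mul_one_sub_cos (hint : Integrable g) (p : Space) :
    Integrable fun x : Space => g x * (1 - Real.cos ⟪p, x⟫) := by
  refine hint.mul_bdd (c := 2) ?_ ?_
  · exact (continuous_const.sub (Real.continuous_cos.comp (continuous_const.inner continuous_id))).aestronglyMeasurable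
  · filter_upwards with x
    rw [Real.norm_eq_abs, abs_le]
    constructor <;> linarith [Real.cos_le_one ⟪p, x⟫, Real.neg_one_le_cos ⟪p, x⟫]

/-- The integrand `g(x) sin(p·x)` is integrable. [folklore] -/
theorem integrable_mul_sin_inner (hint : Integrable g) (p : Space) :
    Integrable fun x : Space => g x * Real.sin ⟪p, x⟫ := by
  refine hint.mul_bdd (c := 1) ?_ ?_
  · exact (Real.continuous_sin.comp (continuous_const.inner continuous_id)).aestronglyMeasurable
  · filter_upwards with x
    rw [Real.norm_eq_abs]; exact Real.abs_sin_le_one _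

/-- **`0 ≤ ∫ g(1 - cos(p·x)) ≤ ½|p|²R² ∫ g`** for `g ≥ 0` supported in the ball of radius `R`.
[cite: FournaisEtAl2024, proof of Lemma 8.1 ("|ĝ(p) - ĝ(0)| ≤ R²ĝ(0)|p|²")] -/
theorem integral_mul_one_sub_cos_inner_le (hg0 : ∀ x, 0 ≤ g x)
    (hsupp : ∀ x, R < ‖x‖ → g x = 0) (hint : Integrable g) (p : Space) :
    0 ≤ ∫ x : Space, g x * (1 - Real.cos ⟪p, x⟫) ∧
      ∫ x : Space, g x * (1 - Real.cos ⟪p, x⟫) ≤ ‖p‖ ^ 2 * R ^ 2 / 2 * ∫ x : Space, g x := by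
  constructor
  · exact integral_nonneg fun x => mul_nonneg (hg0 x) (by linarith [Real.cos_le_one ⟪p, x⟫])
  · rw [← integral_const_mul]
    refine integral_mono (integrable_mul_one_sub_cos hint p) (hint.const_mul _) fun x => ?_
    dsimp only
    rcases le_or_gt ‖x‖ R with hx | hx
    · rw [mul_comm]
      exact mul_le_mul_of_nonneg_right (one_sub_cos_inner_le hx p) (hg0 x)
    · rw [hsupp x hx]; simp

/-- **The imaginary part of `ĝ(p) = ∫ g e^{-ip·x}` vanishes** (even `g`). [cite: FournaisEtAl2024, proof of Lemma 7.2] -/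
theorem im_fourier_eq_zero (heven : ∀ x, g (-x) = g x) (hint : Integrable g) (p : Space) :
    (∫ x : Space, (g x : ℂ) * Complex.exp (-(⟪p, x⟫ : ℂ) * Complex.I)).im = 0 := by
  have h : ∀ x : Space, ((g x : ℂ) * Complex.exp (-(⟪p, x⟫ : ℂ) * Complex.I)).im =
      -(g x * Real.sin ⟪p, x⟫) := by
    intro x
    rw [show -(⟪p, x⟫ : ℂ) * Complex.I = ((-⟪p, x⟫ : ℝ) : ℂ) * Complex.I by push_cast; ring,
      Complex.exp_mul_I, Complex.mul_im]
    simp only [Complex.ofReal_re, Complex.ofReal_im, zero_mul, add_zero, Complex.add_im,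
      Complex.mul_im, Complex.I_re, Complex.I_im, mul_zero, mul_one]
    rw [← Complex.ofReal_cos, ← Complex.ofReal_sin, Complex.ofReal_im, Complex.ofReal_re,
      Real.sin_neg]
    ring
  have hF : Integrable fun x : Space => (g x : ℂ) * Complex.exp (-(⟪p, x⟫ : ℂ) * Complex.I) := by
    refine hint.ofReal.mul_bdd (c := 1) ?_ ?_
    · exact (Complex.continuous_exp.comp (((Complex.continuous_ofReal.comp
        (continuous_const.inner continuous_id)).neg).mul continuous_const)).aestronglyMeasurable
    · filter_upwards with x
      rw [show -(⟪p, x⟫ : ℂ) * Complex.I = ((-⟪p, x⟫ : ℝ) : ℂ) * Complex.I by push_cast; ring,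
        Complex.norm_exp_ofReal_mul_I]
  have him := integral_im hF
  simp only [RCLike.im_to_complex] at him
  rw [← him]
  simp_rw [h, integral_neg, integral_mul_sin_inner_eq_zero heven p, neg_zero]

/-- **`ĝ(0) - Re ĝ(p) = ∫ g(1 - cos(p·x))`.** [cite: FournaisEtAl2024, proof of Lemma 8.1] -/
theorem fourier_zero_sub_re_fourier (hint : Integrable g) (p : Space) :
    (∫ x : Space, g x) - (∫ x : Space, (g x : ℂ) * Complex.exp (-(⟪p, x⟫ : ℂ) * Complex.I)).re =
      ∫ x : Space, g x * (1 - Real.cos ⟪p, x⟫) := by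
  have h : ∀ x : Space, ((g x : ℂ) * Complex.exp (-(⟪p, x⟫ : ℂ) * Complex.I)).re =
      g x * Real.cos ⟪p, x⟫ := by
    intro x
    rw [show -(⟪p, x⟫ : ℂ) * Complex.I = ((-⟪p, x⟫ : ℝ) : ℂ) * Complex.I by push_cast; ring,
      Complex.exp_mul_I]
    simp only [Complex.mul_re, Complex.ofReal_re, Complex.ofReal_im, zero_mul, sub_zero,
      Complex.add_re, Complex.mul_re, Complex.I_re, Complex.I_im, mul_zero, mul_one, zero_sub]
    rw [← Complex.ofReal_cos, ← Complex.ofReal_sin, Complex.ofReal_re, Complex.ofReal_im,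
      Real.cos_neg]
    ring
  have hF : Integrable fun x : Space => (g x : ℂ) * Complex.exp (-(⟪p, x⟫ : ℂ) * Complex.I) := by
    refine hint.ofReal.mul_bdd (c := 1) ?_ ?_
    · exact (Complex.continuous_exp.comp (((Complex.continuous_ofReal.comp
        (continuous_const.inner continuous_id)).neg).mul continuous_const)).aestronglyMeasurable
    · filter_upwards with x
      rw [show -(⟪p, x⟫ : ℂ) * Complex.I = ((-⟪p, x⟫ : ℝ) : ℂ) * Complex.I by push_cast; ring,
        Complex.norm_exp_ofReal_mul_I]
  have hre := integral_re hF
  simp only [RCLike.re_to_complex] at hre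
  rw [← hre]
  simp_rw [h]
  have hcos : Integrable fun x : Space => g x * Real.cos ⟪p, x⟫ :=
    hint.mul_bdd (c := 1)
      ((Real.continuous_cos.comp (continuous_const.inner continuous_id)).aestronglyMeasurable)
      (Eventually.of_forall fun x => by rw [Real.norm_eq_abs]; exact Real.abs_cos_le_one _)
  rw [← integral_sub hint hcos]
  refine integral_congr_ae (Eventually.of_forall fun x => ?_)
  simp only; ring

/-- **`|ĝ(p) - ĝ(0)| ≤ ½R²|p|² ĝ(0)`** for `g ≥ 0` even, supported in the ball of radius `R`,
`ĝ(p) = ∫ g(x)e^{-ip·x}dx` (so `ĝ(0) = ∫ g`; the paper states the constant `1`).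
[cite: FournaisEtAl2024, remark after (2.38) and proof of Lemma 8.1] -/
theorem norm_fourier_sub_fourier_zero_le_sq (hg0 : ∀ x, 0 ≤ g x)
    (hsupp : ∀ x, R < ‖x‖ → g x = 0) (hint : Integrable g) (heven : ∀ x, g (-x) = g x) (p : Space) :
    ‖(∫ x : Space, (g x : ℂ) * Complex.exp (-(⟪p, x⟫ : ℂ) * Complex.I)) - (∫ x : Space, g x : ℝ)‖ ≤
      ‖p‖ ^ 2 * R ^ 2 / 2 * ∫ x : Space, g x := by
  set G : ℂ := ∫ x : Space, (g x : ℂ) * Complex.exp (-(⟪p, x⟫ : ℂ) * Complex.I) with hG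
  have him : G.im = 0 := im_fourier_eq_zero heven hint p
  have hre : (∫ x : Space, g x) - G.re = ∫ x : Space, g x * (1 - Real.cos ⟪p, x⟫) :=
    fourier_zero_sub_re_fourier hint p
  obtain ⟨h0, h1⟩ := integral_mul_one_sub_cos_inner_le hg0 hsupp hint p
  have hdiff : G - ((∫ x : Space, g x : ℝ) : ℂ) = ((G.re - ∫ x : Space, g x : ℝ) : ℂ) := by
    apply Complex.ext <;> simp [him]
  rw [hdiff, Complex.norm_real, Real.norm_eq_abs, abs_sub_comm, hre, abs_of_nonneg h0]
  exact h1

/-- **`|ĝ(p)| ≤ ĝ(0) = ∫ g`** for `g ≥ 0`. [cite: FournaisEtAl2024, proof of Lemma 7.2 ("‖ĝ‖∞ ≤ Ca")] -/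
theorem norm_fourier_le (hg0 : ∀ x, 0 ≤ g x) (p : Space) :
    ‖∫ x : Space, (g x : ℂ) * Complex.exp (-(⟪p, x⟫ : ℂ) * Complex.I)‖ ≤ ∫ x : Space, g x := by
  refine (norm_integral_le_integral_norm _).trans (le_of_eq (integral_congr_ae (Eventually.of_forall fun x => ?_)))
  simp only
  rw [norm_mul, show -(⟪p, x⟫ : ℂ) * Complex.I = ((-⟪p, x⟫ : ℝ) : ℂ) * Complex.I by push_cast; ring,
    Complex.norm_exp_ofReal_mul_I, mul_one, Complex.norm_real, Real.norm_of_nonneg (hg0 x)]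

end Literature.MathematicalPhysics.QuantumManyBody.BoseGas
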